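import Summits.AtomisticToContinuum.BoseEinsteinCondensation.Theses.BECZeroCrossingDilute
import Summits.AtomisticToContinuum.BoseEinsteinCondensation.Theorems.BECZeroCrossingDiluteNearIsotropicDiluteBECPenalisedPerron
import HarnessLib

/-!
# `PenaltySelectsSectorXXZ` (support item stmt-AtomisticToContinuum-13908 of route BECZeroCrossingDilute)

For `L ≥ 1` (`[NeZero L]`), `N ≤ L³` and `0 ≤ Δ ≤ 1`, every ground vector of the penalised easy-plane
XXZ ferromagnet `H_Δ + 4L³·(S³_tot + (L³/2 − N)·1)²` on `(ℤ/Lℤ)³` is annihilated by the sector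
selector `S³_tot + (L³/2 − N)·1`, i.e. has exactly `N` up spins (`N` hard-core bosons). This is the
case `d = 3` of `nidA_penSel_xxz` (landed with stub A of the crux line `birth` of
`NearIsotropicDiluteBEC`): the selector is the integer diagonal `diag(L³ − W(σ) − N)`, `H_Δ`
preserves the weight, its quadratic form is `≥ −¾|E|‖φ‖²` and its diagonal entries are `≤ ¼|E|`,
`|E| ≤ 3L³`, so the penalty `4L³ > ¾|E| + ¼|E|` of any wrong sector cannot be compensated
(`nidA_penSel_core'`). Tasaki (2020) §2.2; Kennedy–Lieb–Shastry (1988).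
-/

open Literature.MathematicalPhysics.QuantumLattice Literature.Probability.LatticeModels Matrix
  Summit.AtomisticToContinuum.BoseEinsteinCondensation.Cruxes.NearIsotropicDiluteBEC.Birth in
/-- **`PenaltySelectsSectorXXZ` (item stmt-AtomisticToContinuum-13908), proved and concluded BY
NAME**: ground vectors of `H_Δ + 4L³(S³_tot + L³/2 − N)²` lie in the sector `S³_tot = N − L³/2`
(`0 ≤ Δ ≤ 1`, `N ≤ L³`). Case `d = 3` of `nidA_penSel_xxz`. [folklore] -/
theorem Summit.AtomisticToContinuum.BoseEinsteinCondensation.Theorems.PenaltySelectsSectorXXZ_proof :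
    Summit.AtomisticToContinuum.BoseEinsteinCondensation.Theses.BECZeroCrossingDilute.PenaltySelectsSectorXXZ := by
  intro L _ N hN Δ hΔ0 hΔ1 ψ hψ
  exact nidA_penSel_xxz 3 L N hN hΔ0 hΔ1 ψ hψ
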